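import Mathlib
import Summits.NavierStokesRegularity.NavierStokesRegularity.Theorems.EulerZoomLiouvillePowerGaugeEulerLiouvilleSelfSimilarStrainExcessGrowth
import Summits.NavierStokesRegularity.NavierStokesRegularity.Theorems.EulerZoomLiouvillePowerGaugeEulerLiouvilleSelfSimilarPressureParkingAverageGrowth
import Summits.NavierStokesRegularity.NavierStokesRegularity.Theorems.EulerZoomLiouvillePowerGaugeEulerLiouvilleSelfSimilarPastPressureGrowth
import Summits.NavierStokesRegularity.NavierStokesRegularity.Theorems.EulerZoomLiouvillePowerGaugeEulerLiouvilleSelfSimilarPastStrata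
import Summits.NavierStokesRegularity.NavierStokesRegularity.Theorems.EulerZoomLiouvillePowerGaugeEulerLiouvilleSelfSimilarBernoulliBoundedVortical
import Summits.NavierStokesRegularity.NavierStokesRegularity.Theorems.EulerZoomLiouvillePowerGaugeEulerLiouvilleSelfSimilarShiftedBoundedC2
import HarnessLib

/-!
# The PAST TWIN (any `T₁ ≤ T`, `T₁ ≤ 0`) of the T2 strata «nor sub-critical strain-excess growth / vortex-dominated far field with bounded vortical
# Bernoulli levels» for the crux `EulerZoomLiouville.PowerGaugeEulerLiouville` (stmt-NavierStokesRegularity-19832; LEAD ns-typeII-p2 g12 v75 «past twin: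
# yes please»; width seat ns-ezl-w1 g4)

Route №10 `EulerZoomLiouville` (NavierStokesRegularity).  Binder prefix of ezl-w5's p645615 (`IsPastSelfSimilar ρ T T₁ x₀ u V` + `C²` + profile hypotheses):
exact self-similarity about `(T, x₀)` for `τ < T₁` only.  A genuinely past member never shows its profile near the collapse, so the WEIGHTED `D`-datum of the
origin-anchored chain is replaced by the DYADIC growth `∫_{B_L}|P|^{3/2} ≤ C_D L^{2−2ρ}` (`PressureParking.profile_pressure_growth_of_gaugeD_past`, far-past
window) and the sub-quadratic ball averages come from `PressureParking.integral_probeBump_pressure_le_of_growth` (Hölder + Chebyshev); the bridge `P = P′ + c₀`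
is taken on the far-past EXTENSION (`Shifted.isDistributional_selfSimilarCollapse_of_past` + `WeakToClassical.pressureProfile_ae_eq_add_const`); the rest of the
contradiction (strain-excess growth `q < 2 + ⅔(1+2ρ)` vs pressurised excess `κ‖y‖²`) is verbatim the origin proof; the kill is profile-level:
`Loc.curl_eq_zero_of_vortical_bernoulli_le` ⇒ `Past.profile_eq_zero_of_irrotationalC2` ⇒ `Past.ae_eq_zero_of_profile_eq_zero`.

* `unpressurised_of_strainExcessGrowth_past`,
* `selfSimilar_ae_eq_zero_of_strainExcessGrowth_boundedVorticalBernoulliC2_profile_past`,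
* `selfSimilar_ae_eq_zero_of_vortexDominated_boundedVorticalBernoulliC2_profile_past`.

HONEST LABEL: portrait strata (past disjunct).  WHAT THIS IS NOT: not NS, not E — `--supports` stmt-19832; 19832 OPEN. [folklore]
-/

noncomputable section

-- flat `Theorems/<Route><Decl>…` files of one crux share the namespace of the crux (tree convention)
set_option linter.dupNamespace false

open MeasureTheory Set Filter Topology Metric Function InnerProductSpace TopologicalSpace
open scoped RealInnerProductSpace NNReal ENNReal

namespace Summit.NavierStokesRegularity.NavierStokesRegularity.Theorems.PowerGaugeEulerLiouville.PressureParking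

open Literature.Analysis Literature.Analysis.FunctionSpaces Literature.Analysis.FluidPDE

/-- **SUB-CRITICAL STRAIN-EXCESS GROWTH ⇒ UNPRESSURISED FAR FIELD, PAST FORM.**  Member exactly self-similar about `(T, x₀)` for `τ < T₁`
(`T₁ ≤ 0`, `T₁ ≤ T`, `0 < ρ < 1`), distributional Euler pair on the slab with the `D`-gauge, `C²` profile `V` with strain excess `≤ A‖z‖^q` far out
(`0 ≤ q < 2 + ⅔(1+2ρ)`): every classical pressure `P′` of `V` has `P′(y) ≤ ε‖y‖²` far out, for every `ε > 0`. [folklore] -/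
theorem unpressurised_of_strainExcessGrowth_past {ρ T T₁ : ℝ} (hρ : 0 < ρ) (hρ1 : ρ < 1) (hT₁ : T₁ ≤ 0) (hTT₁ : T₁ ≤ T)
    (x₀ : EuclideanSpace ℝ (Fin 3))
    {u : ℝ → EuclideanSpace ℝ (Fin 3) → EuclideanSpace ℝ (Fin 3)} {p : ℝ → EuclideanSpace ℝ (Fin 3) → ℝ} {c : ℝ≥0}
    (hsol : IsDistributionalNSSolutionOn (slab (EuclideanSpace ℝ (Fin 3)) (Iio 0) isOpen_Iio) 0 0 u p)
    (hD : ∀ a : ℝ, 0 < a → ENNReal.ofReal (a ^ (2 * ρ)) * cknD a (0 : ℝ × EuclideanSpace ℝ (Fin 3)) p ≤ (c : ℝ≥0∞))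
    {V : EuclideanSpace ℝ (Fin 3) → EuclideanSpace ℝ (Fin 3)} {P : EuclideanSpace ℝ (Fin 3) → ℝ}
    (hu : ∀ τ : ℝ, τ < T₁ → u τ = fun x => selfSimilarCollapse (1 / (2 + ρ)) T V τ (x - x₀))
    (hp : ∀ τ : ℝ, τ < T₁ → p τ = fun x => selfSimilarCollapsePressure (1 / (2 + ρ)) T P τ (x - x₀))
    (hV : ContDiff ℝ 2 V)
    (hQ : ∃ A q R₀ : ℝ, 0 ≤ A ∧ 0 ≤ q ∧ q < 2 + 2 * (1 + 2 * ρ) / 3 ∧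
      ∀ z : EuclideanSpace ℝ (Fin 3), R₀ ≤ ‖z‖ → frobeniusNormSq (fderiv ℝ V z) - ‖curl V z‖ ^ 2 ≤ A * ‖z‖ ^ q)
    {P' : EuclideanSpace ℝ (Fin 3) → ℝ} (hprof : IsSelfSimilarEulerProfile (1 / (2 + ρ)) 0 V P')
    {ε : ℝ} (hε : 0 < ε) :
    ∃ R₁ : ℝ, ∀ y : EuclideanSpace ℝ (Fin 3), R₁ ≤ ‖y‖ → P' y ≤ ε * ‖y‖ ^ 2 := by
  obtain ⟨A, q, R₀, hA, hq0, hq, hfar⟩ := hQ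
  have h2ρ : (0 : ℝ) < 2 + ρ := by linarith
  have hγ : (0 : ℝ) < 1 / (2 + ρ) := one_div_pos.2 h2ρ
  have hγ1 : 1 / (2 + ρ) ≤ 1 := by rw [div_le_one h2ρ]; linarith
  have hm : 0 < baseBumpMass (EuclideanSpace ℝ (Fin 3)) := baseBumpMass_pos
  set v₁ : ℝ := (volume (ball (0 : EuclideanSpace ℝ (Fin 3)) 1)).toReal with hv₁
  have hv : 0 ≤ v₁ := ENNReal.toReal_nonneg
  -- ## the far-past extension, the bridge `P = P′ + c₀`, and the dyadic `D`-growth of `P′ + c₀`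
  have hext := Shifted.isDistributional_selfSimilarCollapse_of_past hT₁ hTT₁ x₀ hsol hu hp
  have hpm0 : AEStronglyMeasurable (uncurry (selfSimilarCollapsePressure (1 / (2 + ρ)) 0 P))
      (volume.restrict (Iio (0 : ℝ) ×ˢ (univ : Set (EuclideanSpace ℝ (Fin 3))))) := by
    have := hext.2.2.1.aestronglyMeasurable
    simpa [slab] using this
  have hPm : AEStronglyMeasurable P volume :=
    aestronglyMeasurable_pressureProfile (p := selfSimilarCollapsePressure (1 / (2 + ρ)) 0 P) hpm0 fun _ _ => rfl
  have hP1 : LocallyIntegrable P volume :=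
    Shifted.locallyIntegrable_pressureProfile_of_slab hγ.le hγ1 hPm hext.2.2.1
  obtain ⟨c₀, hc₀⟩ := WeakToClassical.pressureProfile_ae_eq_add_const hext (fun _ _ => rfl) (fun _ _ => rfl) hV hP1 hprof
  have hprof'' : IsSelfSimilarEulerProfile (1 / (2 + ρ)) 0 V (fun y => P' y + c₀) := hprof.add_const
  have hpm : AEStronglyMeasurable (uncurry p)
      (volume.restrict (Iio (0 : ℝ) ×ˢ (univ : Set (EuclideanSpace ℝ (Fin 3))))) := by
    have := hsol.2.2.1.aestronglyMeasurable
    simpa [slab] using this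
  obtain ⟨CD, hCD, hgrowthP⟩ := profile_pressure_growth_of_gaugeD_past hρ hρ1 hT₁ hTT₁ x₀ hpm hp hD
  have hgrowth : ∀ L : ℝ, 1 ≤ L → ∫⁻ y in ball (0 : EuclideanSpace ℝ (Fin 3)) L, ‖P' y + c₀‖ₑ ^ (3 / 2 : ℝ) ≤
      ENNReal.ofReal (CD * L ^ (2 - 2 * ρ)) := by
    intro L hL
    have e : (fun y : EuclideanSpace ℝ (Fin 3) => ‖P' y + c₀‖ₑ ^ (3 / 2 : ℝ)) =ᵐ[volume.restrict (ball (0 : EuclideanSpace ℝ (Fin 3)) L)]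
        fun y => ‖P y‖ₑ ^ (3 / 2 : ℝ) := by
      filter_upwards [ae_restrict_of_ae hc₀] with y hy
      rw [hy]
    rw [lintegral_congr_ae e]
    exact hgrowthP L hL
  have hκ : 0 < ε / 6 := by positivity
  obtain ⟨C, L₁, hC, hL₁, havg⟩ := integral_probeBump_pressure_le_of_growth hprof'' hCD hgrowth hκ
  -- ## constants
  obtain ⟨D, hDdef⟩ : ∃ D : ℝ, D = (C / (ε / 6) + 1) ^ (1 / 3 : ℝ) := ⟨_, rfl⟩
  have hCk : 0 < C / (ε / 6) + 1 := by positivity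
  have hD0 : 0 < D := by rw [hDdef]; exact Real.rpow_pos_of_pos hCk _
  obtain ⟨e, hedef⟩ : ∃ e : ℝ, e = q - 2 * (1 + 2 * ρ) / 3 := ⟨_, rfl⟩
  have he2 : 0 < 2 - e := by rw [hedef]; linarith
  obtain ⟨K₀, hK₀⟩ : ∃ K₀ : ℝ, K₀ = 8 * v₁ / baseBumpMass (EuclideanSpace ℝ (Fin 3)) *
    (C / (ε / 6) + 1) ^ (2 / 3 : ℝ) * (A * (1 + 2 * D) ^ q) := ⟨_, rfl⟩
  have hK₀0 : 0 ≤ K₀ := by rw [hK₀]; positivity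
  obtain ⟨Lbig, hLbig⟩ : ∃ Lbig : ℝ, Lbig = (K₀ / (ε / 6) + 1) ^ (2 - e)⁻¹ := ⟨_, rfl⟩
  refine ⟨max L₁ (max (max 1 (C / (ε / 6) + 1)) (max (R₀ + 2 * D) (max (2 * |c₀| / ε + 1) Lbig))), fun y hy => ?_⟩
  have hyL₁ : L₁ ≤ ‖y‖ := (le_max_left _ _).trans hy
  have hy' := (le_max_right _ _).trans hy
  have hy1 : 1 ≤ ‖y‖ := ((le_max_left _ _).trans (le_max_left _ _)).trans hy'
  have hyC : C / (ε / 6) + 1 ≤ ‖y‖ := ((le_max_right _ _).trans (le_max_left _ _)).trans hy'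
  have hy'' := (le_max_right _ _).trans hy'
  have hyR : R₀ + 2 * D ≤ ‖y‖ := (le_max_left _ _).trans hy''
  have hyc : 2 * |c₀| / ε + 1 ≤ ‖y‖ := ((le_max_left _ _).trans (le_max_right _ _)).trans hy''
  have hybig : Lbig ≤ ‖y‖ := ((le_max_right _ _).trans (le_max_right _ _)).trans hy''
  set L : ℝ := ‖y‖ with hLdef
  have hL0 : 0 < L := by linarith
  by_contra hPy
  rw [not_le] at hPy
  -- `y` is pressurised
  have hc₀' : |c₀| ≤ ε / 2 * L ^ 2 := by
    have h1 : 2 * |c₀| / ε ≤ L := by linarith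
    rw [div_le_iff₀ hε] at h1
    have hLL : L ≤ L ^ 2 := le_self_pow₀ hy1 two_ne_zero
    have h2 : L * ε ≤ L ^ 2 * ε := mul_le_mul_of_nonneg_right hLL hε.le
    linarith
  have hpress : 3 * (ε / 6) * L ^ 2 ≤ P' y + c₀ := by
    linarith [hPy, neg_abs_le c₀, hc₀']
  -- the averaging radius `R = (…L^{−1−2ρ})^{1/3}`
  obtain ⟨Aκ, hAκ⟩ : ∃ Aκ : ℝ, Aκ = (C / (ε / 6) + 1) * L ^ (-1 - 2 * ρ) := ⟨_, rfl⟩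
  have hAκ0 : 0 < Aκ := by rw [hAκ]; exact mul_pos hCk (Real.rpow_pos_of_pos hL0 _)
  obtain ⟨R, hRdef⟩ : ∃ R : ℝ, R = Aκ ^ (1 / 3 : ℝ) := ⟨_, rfl⟩
  have hR0 : 0 < R := by rw [hRdef]; exact Real.rpow_pos_of_pos hAκ0 _
  have hR3 : R ^ 3 = Aκ := by
    rw [hRdef, ← Real.rpow_natCast, ← Real.rpow_mul hAκ0.le]; norm_num
  have hLpow1 : L ^ (-1 - 2 * ρ) ≤ 1 := Real.rpow_le_one_of_one_le_of_nonpos hy1 (by linarith)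
  have hAκle : Aκ ≤ C / (ε / 6) + 1 := by
    rw [hAκ]
    calc (C / (ε / 6) + 1) * L ^ (-1 - 2 * ρ) ≤ (C / (ε / 6) + 1) * 1 :=
          mul_le_mul_of_nonneg_left hLpow1 hCk.le
      _ = C / (ε / 6) + 1 := mul_one _
  have hRD : R ≤ D := by
    rw [hRdef, hDdef]
    exact Real.rpow_le_rpow hAκ0.le hAκle (by norm_num)
  have hRL : R ≤ L := by
    refine hRD.trans ?_
    have hD1 : D ≤ C / (ε / 6) + 1 := by
      rw [hDdef]
      have h1 : (1 : ℝ) ≤ C / (ε / 6) + 1 := by linarith [div_nonneg hC hκ.le]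
      calc (C / (ε / 6) + 1) ^ (1 / 3 : ℝ) ≤ (C / (ε / 6) + 1) ^ (1 : ℝ) :=
            Real.rpow_le_rpow_of_exponent_le h1 (by norm_num)
        _ = C / (ε / 6) + 1 := Real.rpow_one _
    exact hD1.trans hyC
  -- average ≤ 2κL², hence the excess ≥ κL²
  have havg' := havg L hyL₁ y le_rfl R hR0 hRL
  have hCterm : C * L ^ (1 - 2 * ρ) / R ^ 3 ≤ ε / 6 * L ^ 2 := by
    rw [hR3, div_le_iff₀ hAκ0, hAκ]
    have e1 : L ^ (1 - 2 * ρ) = L ^ 2 * L ^ (-1 - 2 * ρ) := by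
      rw [← Real.rpow_natCast, ← Real.rpow_add hL0]
      congr 1
      push_cast
      ring
    rw [e1]
    have hLpow : 0 < L ^ (-1 - 2 * ρ) := Real.rpow_pos_of_pos hL0 _
    have : C * (L ^ 2 * L ^ (-1 - 2 * ρ)) = (C / (ε / 6)) * (ε / 6 * L ^ 2) * L ^ (-1 - 2 * ρ) := by
      field_simp
    rw [this]
    have hx : 0 < ε / 6 * L ^ 2 * L ^ (-1 - 2 * ρ) := mul_pos (mul_pos hκ (pow_pos hL0 2)) hLpow
    have e2 : ε / 6 * L ^ 2 * ((C / (ε / 6) + 1) * L ^ (-1 - 2 * ρ)) =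
        C / (ε / 6) * (ε / 6 * L ^ 2) * L ^ (-1 - 2 * ρ) + ε / 6 * L ^ 2 * L ^ (-1 - 2 * ρ) := by ring
    rw [e2]
    linarith
  have hex : ε / 6 * L ^ 2 ≤ (fun y => P' y + c₀) y - ∫ z, probeBump R z * (fun y => P' y + c₀) (y + z) := by
    simp only
    linarith
  -- the defect bound from the strain-excess growth
  have hB0 : 0 ≤ A * (L + 2 * D) ^ q := by positivity
  have hgB : ∀ z ∈ ball y (2 * R), frobeniusNormSq (fderiv ℝ V z) - ‖curl V z‖ ^ 2 ≤ A * (L + 2 * D) ^ q := by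
    intro z hz
    rw [mem_ball, dist_eq_norm] at hz
    have hz1 : ‖z‖ ≤ L + 2 * D := by
      have := norm_le_norm_add_norm_sub' z y
      rw [hLdef]; linarith
    have hz2 : R₀ ≤ ‖z‖ := by
      have := norm_sub_norm_le y z
      rw [norm_sub_rev] at this
      rw [hLdef] at hyR
      linarith
    exact (hfar z hz2).trans (mul_le_mul_of_nonneg_left (Real.rpow_le_rpow (norm_nonneg _) hz1 hq0) hA)
  have hdef := pressure_defect_le_of_strainExcess_le hprof'' hR0 y hB0 hgB
  -- `R² ≤ (C/κ+1)^{2/3} L^{−2(1+2ρ)/3}` and `(L + 2D)^q ≤ (1+2D)^q L^q`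
  have hR2 : R ^ 2 = (C / (ε / 6) + 1) ^ (2 / 3 : ℝ) * L ^ (-(2 * (1 + 2 * ρ) / 3)) := by
    have e1 : R ^ 2 = Aκ ^ (2 / 3 : ℝ) := by
      rw [hRdef, ← Real.rpow_natCast, ← Real.rpow_mul hAκ0.le]; norm_num
    have e2 : Aκ ^ (2 / 3 : ℝ) = (C / (ε / 6) + 1) ^ (2 / 3 : ℝ) * (L ^ (-1 - 2 * ρ)) ^ (2 / 3 : ℝ) := by
      rw [hAκ, Real.mul_rpow hCk.le (Real.rpow_nonneg hL0.le _)]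
    have e3 : (L ^ (-1 - 2 * ρ)) ^ (2 / 3 : ℝ) = L ^ (-(2 * (1 + 2 * ρ) / 3)) := by
      rw [← Real.rpow_mul hL0.le]
      congr 1
      ring
    rw [e1, e2, e3]
  have hLD : (L + 2 * D) ^ q ≤ (1 + 2 * D) ^ q * L ^ q := by
    rw [← Real.mul_rpow (by positivity) hL0.le]
    have hmono : L + 2 * D ≤ (1 + 2 * D) * L := by
      have h := mul_nonneg (mul_nonneg zero_le_two hD0.le) (sub_nonneg.2 hy1)
      have e3 : (1 + 2 * D) * L = L + 2 * D + 2 * D * (L - 1) := by ring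
      rw [e3]; linarith
    exact Real.rpow_le_rpow (by positivity) hmono hq0
  have hmain : ε / 6 * L ^ 2 ≤ K₀ * L ^ e := by
    have h1 : ε / 6 * L ^ 2 ≤ 8 * v₁ * R ^ 2 * (A * (L + 2 * D) ^ q) / baseBumpMass (EuclideanSpace ℝ (Fin 3)) :=
      hex.trans hdef
    have h2 : 8 * v₁ * R ^ 2 * (A * (L + 2 * D) ^ q) / baseBumpMass (EuclideanSpace ℝ (Fin 3)) ≤
        8 * v₁ * R ^ 2 * (A * ((1 + 2 * D) ^ q * L ^ q)) / baseBumpMass (EuclideanSpace ℝ (Fin 3)) := by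
      gcongr
    have h3 : 8 * v₁ * R ^ 2 * (A * ((1 + 2 * D) ^ q * L ^ q)) / baseBumpMass (EuclideanSpace ℝ (Fin 3)) = K₀ * L ^ e := by
      rw [hR2, hK₀, hedef, show q - 2 * (1 + 2 * ρ) / 3 = -(2 * (1 + 2 * ρ) / 3) + q by ring,
        Real.rpow_add hL0]
      field_simp
    linarith [h1, h2, h3.le]
  -- contradiction for `L ≥ Lbig`
  have hsplit : L ^ 2 = L ^ (2 - e) * L ^ e := by
    rw [← Real.rpow_natCast, ← Real.rpow_add hL0]; norm_num
  have hLe : 0 < L ^ e := Real.rpow_pos_of_pos hL0 _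
  have hkey : ε / 6 * L ^ (2 - e) ≤ K₀ := by
    rw [hsplit] at hmain
    have : (ε / 6 * L ^ (2 - e)) * L ^ e ≤ K₀ * L ^ e := by linarith [hmain]
    exact le_of_mul_le_mul_right this hLe
  have hbig : K₀ / (ε / 6) + 1 ≤ L ^ (2 - e) := by
    have h1 : Lbig ^ (2 - e) = K₀ / (ε / 6) + 1 := by
      rw [hLbig, Real.rpow_inv_rpow (by positivity) he2.ne']
    rw [← h1]
    exact Real.rpow_le_rpow (by rw [hLbig]; positivity) hybig he2.le
  have e4 : K₀ / (ε / 6) * (ε / 6) = K₀ := by field_simp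
  have h1 := mul_le_mul_of_nonneg_left hbig hκ.le
  have e5 : ε / 6 * (K₀ / (ε / 6) + 1) = K₀ / (ε / 6) * (ε / 6) + ε / 6 := by ring
  rw [e5, e4] at h1
  linarith

/-- **PAST TWIN OF THE T2 STRATUM (growth form)**: crux hypotheses verbatim (`0 < ρ ≤ ½`), exact self-similarity about `(T, x₀)` for `τ < T₁`
(`T₁ ≤ 0`, `T₁ ≤ T`), `C²` profile `V`; for every classical pressure the Bernoulli function is bounded above on the vortical set; the strain excess
satisfies `|∇V(z)|²_F − |curl V(z)|² ≤ A‖z‖^q` far out with `0 ≤ q < 2 + ⅔(1+2ρ)` ⇒ the member is trivial. [folklore] -/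
theorem selfSimilar_ae_eq_zero_of_strainExcessGrowth_boundedVorticalBernoulliC2_profile_past {ρ T T₁ : ℝ} (hρ : 0 < ρ)
    (hρh : ρ ≤ 1 / 2) (hT₁ : T₁ ≤ 0) (hTT₁ : T₁ ≤ T) (x₀ : EuclideanSpace ℝ (Fin 3))
    {u : ℝ → EuclideanSpace ℝ (Fin 3) → EuclideanSpace ℝ (Fin 3)} {p : ℝ → EuclideanSpace ℝ (Fin 3) → ℝ}
    {H : ℝ → EuclideanSpace ℝ (Fin 3) → EuclideanSpace ℝ (Fin 3) →L[ℝ] EuclideanSpace ℝ (Fin 3)} {c : ℝ≥0}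
    (hsw : IsSuitableWeakSolutionOn (slab (EuclideanSpace ℝ (Fin 3)) (Iio 0) isOpen_Iio) 0 0 u p)
    (hH : HasWeakSpatialGradientOn (slab (EuclideanSpace ℝ (Fin 3)) (Iio 0) isOpen_Iio) u H)
    (hgauge : ∀ a : ℝ, 0 < a →
      ENNReal.ofReal (a ^ (2 * ρ)) * cknA a (0 : ℝ × EuclideanSpace ℝ (Fin 3)) u +
          ENNReal.ofReal (a ^ ρ) * cknE a (0 : ℝ × EuclideanSpace ℝ (Fin 3)) H +
        ENNReal.ofReal (a ^ (2 * ρ)) * cknD a (0 : ℝ × EuclideanSpace ℝ (Fin 3)) p ≤ (c : ℝ≥0∞))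
    {V : EuclideanSpace ℝ (Fin 3) → EuclideanSpace ℝ (Fin 3)} {P : EuclideanSpace ℝ (Fin 3) → ℝ}
    (hu : ∀ τ : ℝ, τ < T₁ → u τ = fun x => selfSimilarCollapse (1 / (2 + ρ)) T V τ (x - x₀))
    (hp : ∀ τ : ℝ, τ < T₁ → p τ = fun x => selfSimilarCollapsePressure (1 / (2 + ρ)) T P τ (x - x₀))
    (hV : ContDiff ℝ 2 V)
    (hB : ∀ P' : EuclideanSpace ℝ (Fin 3) → ℝ, IsSelfSimilarEulerProfile (1 / (2 + ρ)) 0 V P' →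
      ∃ Mb : ℝ, ∀ y, curl V y ≠ 0 → selfSimilarBernoulli (1 / (2 + ρ)) 0 V P' y ≤ Mb)
    (hQ : ∃ A q R₀ : ℝ, 0 ≤ A ∧ 0 ≤ q ∧ q < 2 + 2 * (1 + 2 * ρ) / 3 ∧
      ∀ z : EuclideanSpace ℝ (Fin 3), R₀ ≤ ‖z‖ → frobeniusNormSq (fderiv ℝ V z) - ‖curl V z‖ ^ 2 ≤ A * ‖z‖ ^ q) :
    uncurry u =ᵐ[volume.restrict (Iio (0 : ℝ) ×ˢ (univ : Set (EuclideanSpace ℝ (Fin 3))))] 0 := by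
  have hρ1 : ρ < 1 := by linarith
  have h2ρ : (0 : ℝ) < 2 + ρ := by linarith
  have hγ : (0 : ℝ) < 1 / (2 + ρ) := one_div_pos.2 h2ρ
  have hγ2 : 1 / (2 + ρ) < 1 / 2 := one_div_lt_one_div_of_lt two_pos (by linarith)
  have hA : ∀ a : ℝ, 0 < a → ENNReal.ofReal (a ^ (2 * ρ)) *
      cknA a (0 : ℝ × EuclideanSpace ℝ (Fin 3)) u ≤ (c : ℝ≥0∞) :=
    fun a ha => le_trans (le_trans le_self_add le_self_add) (hgauge a ha)
  have hD : ∀ a : ℝ, 0 < a → ENNReal.ofReal (a ^ (2 * ρ)) *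
      cknD a (0 : ℝ × EuclideanSpace ℝ (Fin 3)) p ≤ (c : ℝ≥0∞) :=
    fun a ha => le_trans le_add_self (hgauge a ha)
  obtain ⟨P', hprof⟩ := Past.exists_isSelfSimilarEulerProfile hρ hT₁ hTT₁ hsw.distributional hu hp hV
  obtain ⟨Mb, hMb⟩ := hB P' hprof
  have hεpos : 0 < (1 / (2 + ρ)) * (1 - 1 / (2 + ρ)) / 4 := by
    have : 0 < 1 - 1 / (2 + ρ) := by linarith
    positivity
  obtain ⟨R₁, hR₁⟩ := unpressurised_of_strainExcessGrowth_past hρ hρ1 hT₁ hTT₁ x₀ hsw.distributional hD hu hp hV hQ hprof hεpos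
  have hε : (1 / (2 + ρ)) * (1 - 1 / (2 + ρ)) / 4 < (1 / (2 + ρ)) * (1 - 1 / (2 + ρ)) / 2 := by linarith
  have hcurl : ∀ x, curl V x = 0 := fun x =>
    Loc.curl_eq_zero_of_vortical_bernoulli_le hprof hγ hγ2 hMb hε (fun y hy _ => hR₁ y hy) x
  exact Past.ae_eq_zero_of_profile_eq_zero hρ.le hsw hH hgauge hu
    (Past.profile_eq_zero_of_irrotationalC2 hρ hρh hT₁ hTT₁ hsw.distributional hA hu hp hV hcurl)

/-- **PAST TWIN OF THE T2 STRATUM (vortex-dominated form)**: as above with `|∇V(z)|²_F ≤ |curl V(z)|²` for `‖z‖ ≥ R₀`. [folklore] -/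
theorem selfSimilar_ae_eq_zero_of_vortexDominated_boundedVorticalBernoulliC2_profile_past {ρ T T₁ : ℝ} (hρ : 0 < ρ)
    (hρh : ρ ≤ 1 / 2) (hT₁ : T₁ ≤ 0) (hTT₁ : T₁ ≤ T) (x₀ : EuclideanSpace ℝ (Fin 3))
    {u : ℝ → EuclideanSpace ℝ (Fin 3) → EuclideanSpace ℝ (Fin 3)} {p : ℝ → EuclideanSpace ℝ (Fin 3) → ℝ}
    {H : ℝ → EuclideanSpace ℝ (Fin 3) → EuclideanSpace ℝ (Fin 3) →L[ℝ] EuclideanSpace ℝ (Fin 3)} {c : ℝ≥0}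
    (hsw : IsSuitableWeakSolutionOn (slab (EuclideanSpace ℝ (Fin 3)) (Iio 0) isOpen_Iio) 0 0 u p)
    (hH : HasWeakSpatialGradientOn (slab (EuclideanSpace ℝ (Fin 3)) (Iio 0) isOpen_Iio) u H)
    (hgauge : ∀ a : ℝ, 0 < a →
      ENNReal.ofReal (a ^ (2 * ρ)) * cknA a (0 : ℝ × EuclideanSpace ℝ (Fin 3)) u +
          ENNReal.ofReal (a ^ ρ) * cknE a (0 : ℝ × EuclideanSpace ℝ (Fin 3)) H +
        ENNReal.ofReal (a ^ (2 * ρ)) * cknD a (0 : ℝ × EuclideanSpace ℝ (Fin 3)) p ≤ (c : ℝ≥0∞))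
    {V : EuclideanSpace ℝ (Fin 3) → EuclideanSpace ℝ (Fin 3)} {P : EuclideanSpace ℝ (Fin 3) → ℝ}
    (hu : ∀ τ : ℝ, τ < T₁ → u τ = fun x => selfSimilarCollapse (1 / (2 + ρ)) T V τ (x - x₀))
    (hp : ∀ τ : ℝ, τ < T₁ → p τ = fun x => selfSimilarCollapsePressure (1 / (2 + ρ)) T P τ (x - x₀))
    (hV : ContDiff ℝ 2 V)
    (hB : ∀ P' : EuclideanSpace ℝ (Fin 3) → ℝ, IsSelfSimilarEulerProfile (1 / (2 + ρ)) 0 V P' →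
      ∃ Mb : ℝ, ∀ y, curl V y ≠ 0 → selfSimilarBernoulli (1 / (2 + ρ)) 0 V P' y ≤ Mb)
    (hQ : ∃ R₀ : ℝ, ∀ z : EuclideanSpace ℝ (Fin 3), R₀ ≤ ‖z‖ → frobeniusNormSq (fderiv ℝ V z) ≤ ‖curl V z‖ ^ 2) :
    uncurry u =ᵐ[volume.restrict (Iio (0 : ℝ) ×ˢ (univ : Set (EuclideanSpace ℝ (Fin 3))))] 0 := by
  obtain ⟨R₀, hR₀⟩ := hQ
  refine selfSimilar_ae_eq_zero_of_strainExcessGrowth_boundedVorticalBernoulliC2_profile_past hρ hρh hT₁ hTT₁ x₀ hsw hH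
    hgauge hu hp hV hB ⟨0, 0, R₀, le_rfl, le_rfl, by positivity, fun z hz => ?_⟩
  have := hR₀ z hz
  simp only [zero_mul]
  linarith

end Summit.NavierStokesRegularity.NavierStokesRegularity.Theorems.PowerGaugeEulerLiouville.PressureParking

end
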